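import Summits.AtomisticToContinuum.BoseEinsteinCondensation.Theorems.BECConjugateDominationHardCoreExtensionResidueTower

/-!
# Evidence for stub Γ_ess (`stub_essExoticTruncationGap`, line `birth`, crux stmt-AtomisticToContinuum-13906):
# the "essential exotic" class is NOT empty — the hard shell `⊤·1_{[1,2]}` is a member

The hypothesis class of the stub consists of the admissible (`IsRepulsiveFiniteRange`) profiles `v` with
`∫ v(|x|) dx = ⊤` such that EVERY admissible `w` with `v(|x|) = w(|x|)` for a.e. `x ∈ ℝ³` is
(1) unbounded on `[0,∞)`, (2) not locally bounded on `(0,∞)`, (3) not of the hard-core class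
(`⊤` on some `[0,a)`, `a > 0`, bounded beyond every `a' > a`).

`hardShell := (Set.Icc 1 2).indicator ⊤` (i.e. `⊤` on `[1,2]`, `0` elsewhere) is a member
(`hardShell_mem_essExoticClass`, `essExoticClass_nonempty`): the open shell `{1 < |x| < 2}` and the open ball
`{|x| < min a 1}` have positive Lebesgue measure, so an a.e.-modification `w` takes the value `⊤` at some radius in
`(1,2)` and cannot be `⊤` on all of `[0,a)`.  Consequently the stub, as typed, contains the level-uniform dilute
Ky Fan gap of the soft shells `n·1_{[1,2]} ↑ ⊤·1_{[1,2]}` (`stub_implies_hardShell_gap`), whose limiting problem is the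
hard-SHELL gas: its fixed-volume simplicity needs energetic selection of the all-outside sector (one-particle
insertion bound, Disproof §13, not in the tree) AND connectivity mod `S_N` of the hard-sphere free region with
exclusion `b = 2`, i.e. the neighbour stub G (`LemmaGConnected`, open in print).
-/

noncomputable section

namespace Summit.AtomisticToContinuum.BoseEinsteinCondensation.Cruxes.SchemeTransfer.BirthStubs

open MeasureTheory Filter
open scoped ENNReal NNReal Topology
open Literature.MathematicalPhysics.QuantumManyBody.BoseGas

/-! The hard shell profile `⊤·1_{[1,2]}` is written inline as `(Set.Icc (1 : ℝ) 2).indicator (⊤ : ℝ → ℝ≥0∞)`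
(no definition and no notation, so that this evidence file stays a pure-proof file). -/

/-- On the shell `[1,2]` the profile is `⊤`. -/
theorem hardShell_of_mem {r : ℝ} (hr : r ∈ Set.Icc (1 : ℝ) 2) : (Set.Icc (1 : ℝ) 2).indicator (⊤ : ℝ → ℝ≥0∞) r = ⊤ := by
  simp [Set.indicator_of_mem hr]

/-- Off the shell `[1,2]` the profile is `0`. -/
theorem hardShell_of_not_mem {r : ℝ} (hr : r ∉ Set.Icc (1 : ℝ) 2) : (Set.Icc (1 : ℝ) 2).indicator (⊤ : ℝ → ℝ≥0∞) r = 0 := by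
  simp [Set.indicator_of_notMem hr]

/-- The hard shell profile is measurable. -/
theorem measurable_hardShell : Measurable ((Set.Icc (1 : ℝ) 2).indicator (⊤ : ℝ → ℝ≥0∞)) :=
  measurable_const.indicator measurableSet_Icc

/-- The hard shell is admissible (measurable, range `2`). -/
theorem isRepulsiveFiniteRange_hardShell : IsRepulsiveFiniteRange ((Set.Icc (1 : ℝ) 2).indicator (⊤ : ℝ → ℝ≥0∞)) :=
  ⟨measurable_hardShell, 2, fun _ hr => hardShell_of_not_mem fun h => (not_le.2 hr) h.2⟩

/-- The open spherical shell `{1 < |x| < 2}` is open and nonempty. -/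
theorem isOpen_openShell : IsOpen {x : Space | 1 < ‖x‖ ∧ ‖x‖ < 2} :=
  (isOpen_lt continuous_const continuous_norm).inter (isOpen_lt continuous_norm continuous_const)

/-- The open spherical shell `{1 < |x| < 2}` is nonempty (it contains a vector of norm `3/2`). -/
theorem openShell_nonempty : ({x : Space | 1 < ‖x‖ ∧ ‖x‖ < 2}).Nonempty := by
  obtain ⟨x, hx⟩ := exists_norm_eq Space (by norm_num : (0 : ℝ) ≤ 3 / 2)
  exact ⟨x, by rw [Set.mem_setOf_eq, hx]; norm_num⟩

/-- An a.e. property on `ℝ³` has a witness in every nonempty open set (Lebesgue measure charges open sets). -/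
theorem exists_mem_of_ae {p : Space → Prop} (h : ∀ᵐ x : Space, p x) {U : Set Space} (hU : IsOpen U)
    (hne : U.Nonempty) : ∃ x ∈ U, p x := by
  by_contra hcon
  push Not at hcon
  have h1 : volume U = 0 := measure_mono_null (fun x hx => hcon x hx) (ae_iff.1 h)
  exact (hU.measure_pos volume hne).ne' h1

/-- The hard shell is NOT integrable: `∫ hardShell(|x|) dx = ⊤`. -/
theorem lintegral_hardShell_eq_top : (∫⁻ x : Space, (Set.Icc (1 : ℝ) 2).indicator (⊤ : ℝ → ℝ≥0∞) ‖x‖) = ⊤ := by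
  refine lintegral_eq_top_of_measure_eq_top_ne_zero
    (measurable_hardShell.comp measurable_norm).aemeasurable ?_
  have hsub : {x : Space | 1 < ‖x‖ ∧ ‖x‖ < 2} ⊆ {x : Space | (Set.Icc (1 : ℝ) 2).indicator (⊤ : ℝ → ℝ≥0∞) ‖x‖ = ⊤} :=
    fun x hx => hardShell_of_mem ⟨hx.1.le, hx.2.le⟩
  exact fun h0 => (isOpen_openShell.measure_pos volume openShell_nonempty).ne' (measure_mono_null hsub h0)

/-- Every a.e.-modification of the hard shell takes the value `⊤` at some radius in `(1,2)`. -/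
theorem exists_eq_top_of_ae_eq_hardShell {w : ℝ → ℝ≥0∞} (h : ∀ᵐ x : Space, (Set.Icc (1 : ℝ) 2).indicator (⊤ : ℝ → ℝ≥0∞) ‖x‖ = w ‖x‖) :
    ∃ r : ℝ, 1 < r ∧ r < 2 ∧ w r = ⊤ := by
  obtain ⟨x, hx, hpx⟩ := exists_mem_of_ae h isOpen_openShell openShell_nonempty
  exact ⟨‖x‖, hx.1, hx.2, by rw [← hpx, hardShell_of_mem ⟨hx.1.le, hx.2.le⟩]⟩

/-- No a.e.-modification of the hard shell is `⊤` on a whole interval `[0,a)`, `a > 0`. -/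
theorem not_core_of_ae_eq_hardShell {w : ℝ → ℝ≥0∞} (h : ∀ᵐ x : Space, (Set.Icc (1 : ℝ) 2).indicator (⊤ : ℝ → ℝ≥0∞) ‖x‖ = w ‖x‖) {a : ℝ}
    (ha : 0 < a) : ¬ ∀ r : ℝ, 0 ≤ r → r < a → w r = ⊤ := by
  intro hcore
  have hU : IsOpen {x : Space | ‖x‖ < min a 1} := isOpen_lt continuous_norm continuous_const
  have hne : ({x : Space | ‖x‖ < min a 1}).Nonempty := ⟨0, by simp [ha]⟩
  obtain ⟨x, hx, hpx⟩ := exists_mem_of_ae h hU hne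
  have hx' : ‖x‖ < min a 1 := hx
  have h0 : (Set.Icc (1 : ℝ) 2).indicator (⊤ : ℝ → ℝ≥0∞) ‖x‖ = 0 := hardShell_of_not_mem fun hm => by
    have := hm.1; have := min_le_right a 1; linarith
  have htop : w ‖x‖ = ⊤ := hcore _ (norm_nonneg _) (hx'.trans_le (min_le_left _ _))
  rw [← hpx, h0] at htop
  exact ENNReal.zero_ne_top htop

/-- **The hard shell lies in the essential exotic class of the stub**: every admissible a.e.-modification is
unbounded, not locally bounded on `(0,∞)`, and not of the hard-core class. (Admissibility of `w` is not even used.) -/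
theorem hardShell_mem_essExoticClass :
    ∀ w : ℝ → ℝ≥0∞, IsRepulsiveFiniteRange w →
      (∀ᵐ x : Space, (Set.Icc (1 : ℝ) 2).indicator (⊤ : ℝ → ℝ≥0∞) ‖x‖ = w ‖x‖) →
      (¬ ∃ C : ℝ≥0, ∀ r : ℝ, 0 ≤ r → w r ≤ C) ∧
      (¬ ∀ δ : ℝ, 0 < δ → ∃ M : ℝ≥0∞, M ≠ ⊤ ∧ ∀ r : ℝ, δ < r → w r ≤ M) ∧
      (¬ ∃ a : ℝ, 0 < a ∧ (∀ r : ℝ, 0 ≤ r → r < a → w r = ⊤) ∧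
        ∀ a' : ℝ, a < a' → ∃ M : ℝ≥0∞, M ≠ ⊤ ∧ ∀ r : ℝ, a' < r → w r ≤ M) := by
  intro w _ h
  obtain ⟨r, hr1, hr2, hwr⟩ := exists_eq_top_of_ae_eq_hardShell h
  refine ⟨?_, ?_, ?_⟩
  · rintro ⟨C, hC⟩
    have := hC r (by linarith)
    rw [hwr, top_le_iff] at this
    exact ENNReal.coe_ne_top this
  · intro hlb
    obtain ⟨M, hM, hMr⟩ := hlb 1 one_pos
    have := hMr r hr1
    rw [hwr, top_le_iff] at this
    exact hM this
  · rintro ⟨a, ha, hcore, -⟩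
    exact not_core_of_ae_eq_hardShell h ha hcore

/-- **The essential exotic class is nonempty** (witness: the hard shell). -/
theorem essExoticClass_nonempty :
    ∃ v : ℝ → ℝ≥0∞, IsRepulsiveFiniteRange v ∧ (∫⁻ x : Space, v ‖x‖) = ⊤ ∧
      ∀ w : ℝ → ℝ≥0∞, IsRepulsiveFiniteRange w → (∀ᵐ x : Space, v ‖x‖ = w ‖x‖) →
        (¬ ∃ C : ℝ≥0, ∀ r : ℝ, 0 ≤ r → w r ≤ C) ∧
        (¬ ∀ δ : ℝ, 0 < δ → ∃ M : ℝ≥0∞, M ≠ ⊤ ∧ ∀ r : ℝ, δ < r → w r ≤ M) ∧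
        (¬ ∃ a : ℝ, 0 < a ∧ (∀ r : ℝ, 0 ≤ r → r < a → w r = ⊤) ∧
          ∀ a' : ℝ, a < a' → ∃ M : ℝ≥0∞, M ≠ ⊤ ∧ ∀ r : ℝ, a' < r → w r ≤ M) :=
  ⟨_, isRepulsiveFiniteRange_hardShell, lintegral_hardShell_eq_top, hardShell_mem_essExoticClass⟩

/-- **What the stub contains**: the statement of `stub_essExoticTruncationGap` (verbatim, as a hypothesis) yields the
level-uniform dilute Ky Fan gap of the soft shells `min(⊤·1_{[1,2]}, n) = n·1_{[1,2]}` — the hard-shell gas, a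
`LemmaGConnected (b = 2)` instance (Disproof §13). So the stub is not vacuous and not weaker than hard-shell simplicity. -/
theorem stub_implies_hardShell_gap
    (hΓ : ∀ v : ℝ → ℝ≥0∞, IsRepulsiveFiniteRange v → (∫⁻ x : Space, v ‖x‖) = ⊤ →
      (∀ w : ℝ → ℝ≥0∞, IsRepulsiveFiniteRange w → (∀ᵐ x : Space, v ‖x‖ = w ‖x‖) →
        (¬ ∃ C : ℝ≥0, ∀ r : ℝ, 0 ≤ r → w r ≤ C) ∧
        (¬ ∀ δ : ℝ, 0 < δ → ∃ M : ℝ≥0∞, M ≠ ⊤ ∧ ∀ r : ℝ, δ < r → w r ≤ M) ∧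
        (¬ ∃ a : ℝ, 0 < a ∧ (∀ r : ℝ, 0 ≤ r → r < a → w r = ⊤) ∧
          ∀ a' : ℝ, a < a' → ∃ M : ℝ≥0∞, M ≠ ⊤ ∧ ∀ r : ℝ, a' < r → w r ≤ M)) →
      ∃ ρ₁ : ℝ, 0 < ρ₁ ∧ ∀ ρ : ℝ, 0 < ρ → ρ < ρ₁ → ∀ᶠ N : ℕ in atTop,
        ∃ γ : ℝ, 0 < γ ∧ ∃ n₀ : ℕ, ∀ n : ℕ, n₀ ≤ n →
          2 * periodicGroundStateEnergy (fun r => min (v r) (n : ℝ≥0∞)) N (sideLength ρ N) +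
              ENNReal.ofReal γ ≤
            kyFanTwo (fun r => min (v r) (n : ℝ≥0∞)) N (sideLength ρ N)) :
    ∃ ρ₁ : ℝ, 0 < ρ₁ ∧ ∀ ρ : ℝ, 0 < ρ → ρ < ρ₁ → ∀ᶠ N : ℕ in atTop,
      ∃ γ : ℝ, 0 < γ ∧ ∃ n₀ : ℕ, ∀ n : ℕ, n₀ ≤ n →
        2 * periodicGroundStateEnergy
              (fun r => min ((Set.Icc (1 : ℝ) 2).indicator (⊤ : ℝ → ℝ≥0∞) r) (n : ℝ≥0∞)) N (sideLength ρ N) +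
            ENNReal.ofReal γ ≤
          kyFanTwo (fun r => min ((Set.Icc (1 : ℝ) 2).indicator (⊤ : ℝ → ℝ≥0∞) r) (n : ℝ≥0∞)) N
            (sideLength ρ N) :=
  hΓ _ isRepulsiveFiniteRange_hardShell lintegral_hardShell_eq_top hardShell_mem_essExoticClass

end Summit.AtomisticToContinuum.BoseEinsteinCondensation.Cruxes.SchemeTransfer.BirthStubs

end
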